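import Mathlib
import Summits.KontsevichZagierPeriods.KontsevichZagierPeriods.Theses.LiouvilleUnfolding
import Literature.NumberTheory.Transcendental.PeriodConjecture
import Literature.NumberTheory.Transcendental.KZCalculusProofs
import Literature.NumberTheory.Transcendental.KZProduct
import Literature.NumberTheory.Transcendental.KZProductIdeal
import Literature.NumberTheory.Transcendental.KZFibredRelations
import Literature.NumberTheory.Transcendental.KZRelationsLE
import Literature.NumberTheory.Transcendental.KZRulesAssociator

/-!
# Sketch — crux idea `spectator-localisation` for crux stmt-KontsevichZagierPeriods-2837
(`LiouvilleUnfolding.LogKernelConjecture`), ideator 2, round 1.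

Invert every non-zero period: the kernel conjecture (hence the five-rule crux) splits EXACTLY into
* `DarkTorsion`      — every kernel element is annihilated, modulo `KZ.relations`, by a spectator of
                        non-zero value (the kernel conjecture for the ring `FormalRep ⧸ relations`
                        localised at all classes of non-zero value: the FIELD-level core);
* `SpectatorCancellation` — classes of non-zero value are non-zero-divisors on `FormalRep ⧸ relations`
                        (transcendence-free; the calculus' "Lefschetz B").
Glue both ways is proved below; the first bricks of the structural half are typed.
-/

set_option linter.dupNamespace false

namespace Summit.KontsevichZagierPeriods.KontsevichZagierPeriods.Cruxes.LogKernelConjecture.SpectatorLocalisation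

open Literature.NumberTheory.Transcendental

/-- FIELD-LEVEL CORE. Every formal combination of value `0` is killed, modulo the four moves, by some
spectator of non-zero value: `eval c = 0 → ∃ s, eval s ≠ 0 ∧ s * c ∈ relations`. Weaker than
`KZ.PiLocalKernel` (spectators `[π]^N`) and than `KZKernelConjecture` (spectator `[pt,1]`). -/
def DarkTorsion : Prop :=
  ∀ c : KZ.FormalRep, KZ.eval c = 0 → ∃ s : KZ.FormalRep, KZ.eval s ≠ 0 ∧ s * c ∈ KZ.relations

/-- STRUCTURAL HALF. A class of non-zero value is a non-zero-divisor on `FormalRep ⧸ relations`: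
`eval s ≠ 0 → s * c ∈ relations → c ∈ relations`. (The ∀-negation of route Neg's `CancellationGap`;
stronger than `KZ.PiCancellation`, weaker than "`FormalRep ⧸ relations` is a domain".) -/
def SpectatorCancellation : Prop :=
  ∀ s c : KZ.FormalRep, KZ.eval s ≠ 0 → s * c ∈ KZ.relations → c ∈ KZ.relations

/-- Glue: the two halves give the kernel form of Conjecture 1. -/
theorem kzKernelConjecture_of (hD : DarkTorsion) (hC : SpectatorCancellation) :
    KZKernelConjecture := by
  intro c hc
  obtain ⟨s, hs, hsc⟩ := hD c hc
  exact hC s c hs hsc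

/-- Glue to the crux BY NAME: the five-rule kernel conjecture of route LiouvilleUnfolding. -/
theorem logKernelConjecture_of (hD : DarkTorsion) (hC : SpectatorCancellation) :
    Summit.KontsevichZagierPeriods.KontsevichZagierPeriods.Theses.LiouvilleUnfolding.LogKernelConjecture := by
  intro R hR _ c hc
  exact hR (kzKernelConjecture_of hD hC c hc)

/-- Converse (i): the kernel conjecture gives `DarkTorsion` with the spectator `[pt, 1]`. -/
theorem darkTorsion_of_kzKernelConjecture (h : KZKernelConjecture) : DarkTorsion := by
  intro c hc
  refine ⟨KZ.of KZ.IntegralRep.unit, ?_, ?_⟩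
  · simp [KZ.eval_of, KZ.IntegralRep.value_unit]
  · exact KZ.of_mul_mem_relations _ (h c hc)

/-- Converse (ii): the kernel conjecture gives `SpectatorCancellation` (soundness + `eval` multiplicative). -/
theorem spectatorCancellation_of_kzKernelConjecture (h : KZKernelConjecture) : SpectatorCancellation := by
  intro s c hs hsc
  apply h
  have h0 : KZ.eval (s * c) = 0 := KZ.relations_le_ker_eval_holds hsc
  rw [KZ.eval_mul' s c] at h0
  rcases mul_eq_zero.mp h0 with h1 | h1
  · exact absurd h1 hs
  · exact h1

/-- Position of the arithmetic half: route AyoubSpecialisation's `KZ.PiLocalKernel` (spectators `[π]^N`)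
implies `DarkTorsion` (reassociate with `KZ.mul_assoc_sub_mem_relations`; `eval [π] = π ≠ 0`). -/
theorem darkTorsion_of_piLocalKernel (h : KZ.PiLocalKernel) : DarkTorsion := by
  -- auxiliary: iterated π-multiplication into relations gives a spectator
  have key : ∀ (N : ℕ) (c : KZ.FormalRep), (fun x => KZ.of KZ.piRep * x)^[N] c ∈ KZ.relations →
      ∃ s : KZ.FormalRep, KZ.eval s ≠ 0 ∧ s * c ∈ KZ.relations := by
    intro N
    induction N with
    | zero =>
      intro c hc
      refine ⟨KZ.of KZ.IntegralRep.unit, ?_, KZ.of_mul_mem_relations _ hc⟩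
      simp [KZ.eval_of, KZ.IntegralRep.value_unit]
    | succ N ih =>
      intro c hc
      rw [Function.iterate_succ_apply] at hc
      obtain ⟨s, hs, hsc⟩ := ih _ hc
      refine ⟨s * KZ.of KZ.piRep, ?_, ?_⟩
      · rw [KZ.eval_mul', KZ.eval_of, KZ.piRep_value]
        exact mul_ne_zero hs Real.pi_ne_zero
      · have hassoc := KZ.mul_assoc_sub_mem_relations s (KZ.of KZ.piRep) c
        have := KZ.relations.add_mem hassoc hsc
        simpa using this
  intro c hc
  obtain ⟨N, hN⟩ := h c hc
  exact key N c hN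

/-- Position of the structural half: `SpectatorCancellation` implies `KZ.PiCancellation`. -/
theorem piCancellation_of_spectatorCancellation (h : SpectatorCancellation) : KZ.PiCancellation := by
  intro c hc
  refine h (KZ.of KZ.piRep) c ?_ hc
  rw [KZ.eval_of, KZ.piRep_value]
  exact Real.pi_ne_zero

/-- The split is exact. -/
theorem kzKernelConjecture_iff : KZKernelConjecture ↔ DarkTorsion ∧ SpectatorCancellation :=
  ⟨fun h => ⟨darkTorsion_of_kzKernelConjecture h, spectatorCancellation_of_kzKernelConjecture h⟩,
   fun h => kzKernelConjecture_of h.1 h.2⟩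

/-! ### First bricks of the structural half (statements; proofs are the line's first stubs) -/

/-- FIRST LEMMA (PROVED below, `algebraicSpectatorCancellation_holds`): spectators that the calculus can evaluate cancel.
If `s ≡ a·[pt,1]` modulo relations for a non-zero real algebraic `a`, then `s * c ∈ relations → c ∈
relations` (scale by `a⁻¹`, `KZ.scale_mem_relations`, `KZ.of_unit_mul_sub_mem_relations`). -/
def AlgebraicSpectatorCancellation : Prop :=
  ∀ (s c : KZ.FormalRep) (a : ℝ) (ha : IsAlgebraic ℚ a), a ≠ 0 →
    s - KZ.scale a ha (KZ.of KZ.IntegralRep.unit) ∈ KZ.relations →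
    s * c ∈ KZ.relations → c ∈ KZ.relations

section AlgebraicSpectators

variable {n m : ℕ}

/-- Scaling commutes with the Fubini product on representations. -/
theorem constMul_prod (a : ℝ) (ha : IsAlgebraic ℚ a) (r : KZ.IntegralRep n) (s : KZ.IntegralRep m) :
    (r.constMul a ha).prod s = (r.prod s).constMul a ha := by
  refine KZ.IntegralRep.ext' rfl ?_
  rw [KZ.IntegralRep.prod_integrand_eq, KZ.IntegralRep.integrand_constMul,
    KZ.IntegralRep.prod_integrand_eq]
  funext z
  rw [KZ.IntegralRep.prodFun_apply, KZ.IntegralRep.prodFun_apply, KZ.IntegralRep.integrand_constMul,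
    mul_assoc]

/-- `scale a (x * y) = scale a x * y` on the formal group. -/
theorem scale_mul (a : ℝ) (ha : IsAlgebraic ℚ a) (x y : KZ.FormalRep) :
    KZ.scale a ha (x * y) = KZ.scale a ha x * y := by
  induction x using FreeAbelianGroup.induction_on with
  | zero => simp
  | of r =>
    induction y using FreeAbelianGroup.induction_on with
    | zero => simp
    | of t =>
      obtain ⟨k, r⟩ := r
      obtain ⟨l, t⟩ := t
      change KZ.scale a ha (KZ.of r * KZ.of t) = KZ.scale a ha (KZ.of r) * KZ.of t
      rw [KZ.of_mul_of, KZ.scale_of, KZ.scale_of, KZ.of_mul_of, constMul_prod]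
    | neg t ih => rw [mul_neg, map_neg, ih, mul_neg]
    | add t u iht ihu => rw [mul_add, map_add, iht, ihu, mul_add]
  | neg r ih => rw [neg_mul, map_neg, ih, map_neg, neg_mul]
  | add u v ihu ihv => rw [add_mul, map_add, ihu, ihv, map_add, add_mul]

/-- Unscaling: `scale a⁻¹ (scale a c) = c` for `a ≠ 0`. -/
theorem scale_inv_scale (a : ℝ) (ha : IsAlgebraic ℚ a) (ha' : IsAlgebraic ℚ a⁻¹) (ha0 : a ≠ 0)
    (c : KZ.FormalRep) : KZ.scale a⁻¹ ha' (KZ.scale a ha c) = c := by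
  induction c using FreeAbelianGroup.induction_on with
  | zero => simp
  | of r =>
    obtain ⟨k, r⟩ := r
    change KZ.scale a⁻¹ ha' (KZ.scale a ha (KZ.of r)) = KZ.of r
    rw [KZ.scale_of, KZ.scale_of]
    congr 1
    refine KZ.IntegralRep.ext' rfl ?_
    funext z
    simp [KZ.IntegralRep.integrand_constMul, ha0]
  | neg r ih => rw [map_neg, map_neg, ih]
  | add u v ihu ihv => rw [map_add, map_add, ihu, ihv]

/-- `AlgebraicSpectatorCancellation` HOLDS: spectators the calculus evaluates to a non-zero algebraic
constant cancel (right ideal, `scale_mul`, `KZ.of_unit_mul_sub_mem_relations`, `KZ.scale_mem_relations`,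
unscaling). -/
theorem algebraicSpectatorCancellation_holds : AlgebraicSpectatorCancellation := by
  intro s c a ha ha0 hs hsc
  set t : KZ.FormalRep := KZ.scale a ha (KZ.of KZ.IntegralRep.unit) with ht
  -- (s - t) * c ∈ relations (right ideal), hence t * c ∈ relations
  have h1 : (s - t) * c ∈ KZ.relations := KZ.mul_mem_relations_right_holds _ _ hs
  have h2 : t * c ∈ KZ.relations := by
    have : t * c = s * c - (s - t) * c := by rw [sub_mul]; abel
    rw [this]
    exact KZ.relations.sub_mem hsc h1
  -- t * c = scale a ([pt,1] * c)
  have h3 : KZ.scale a ha (KZ.of KZ.IntegralRep.unit * c) ∈ KZ.relations := by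
    rw [scale_mul]; exact h2
  -- scale a c ∈ relations
  have h4 : KZ.scale a ha c ∈ KZ.relations := by
    have h5 : KZ.scale a ha (KZ.of KZ.IntegralRep.unit * c - c) ∈ KZ.relations :=
      KZ.scale_mem_relations a ha (KZ.of_unit_mul_sub_mem_relations c)
    rw [map_sub] at h5
    have := KZ.relations.sub_mem h3 h5
    simpa using this
  -- unscale
  have ha' : IsAlgebraic ℚ a⁻¹ := ha.inv
  have h6 := KZ.scale_mem_relations a⁻¹ ha' h4
  rwa [scale_inv_scale a ha ha' ha0] at h6

end AlgebraicSpectators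

/-- FIRST LEMMA OF THE LINE PROPER (theorem-candidate, M): FIBRED certificates cancel. If the
certificate for `[s] * c` (spectator `s` one-dimensional, carried in coordinate `0`) lies in the
subgroup `KZ.fibredRelations` generated by the moves that never move the spectator coordinate, then
`c ∈ KZ.relations`: restrict the whole certificate to a generic ALGEBRAIC fibre `z 0 = y₀` with
`s.integrand y₀ ≠ 0` (the bad `y₀` form a null ℚ-semialgebraic subset of ℝ, hence a finite set), which
turns it into a certificate for `KZ.scale (s.integrand y₀) _ c`, and unscale. -/
def FibredSpectatorCancellation : Prop :=
  ∀ (s : KZ.IntegralRep 1) (c : KZ.FormalRep), s.value ≠ 0 →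
    KZ.of s * c ∈ KZ.fibredRelations → c ∈ KZ.relations

/-- Tameness side condition for the tree-only version of the engine: every representation occurring in
`x` has bounded domain and bounded integrand (then EVERY fibre is an `IntegralRep`, no o-minimal input). -/
def AllBounded (x : KZ.FormalRep) : Prop :=
  ∀ g ∈ x.support, Bornology.IsBounded g.2.domain ∧
    ∃ M : ℝ, ∀ z ∈ g.2.domain, |g.2.integrand z| ≤ M

/-- The BOUNDED fibred sub-calculus: fibred generators all of whose representations are bounded. -/
def fibredRelationsBdd : AddSubgroup KZ.FormalRep :=
  AddSubgroup.closure (KZ.fibredGenerators ∩ {x | AllBounded x})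

theorem fibredRelationsBdd_le : fibredRelationsBdd ≤ KZ.fibredRelations :=
  AddSubgroup.closure_mono Set.inter_subset_left

/-- FIRST LEMMA, tree-only form (theorem-candidate, M; no named fact needed): bounded fibred certificates
cancel. For bounded data every fibre over an algebraic `y₀` is an `IntegralRep`, and the only bad parameters
are those where a null overlap has a non-null fibre — a null ℚ-semialgebraic subset of `ℝ`, i.e. finite. -/
def FibredSpectatorCancellationBdd : Prop :=
  ∀ (s : KZ.IntegralRep 1) (c : KZ.FormalRep), s.value ≠ 0 →
    KZ.of s * c ∈ fibredRelationsBdd → c ∈ KZ.relations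

/-- The open structural stub in fibration form: every certificate for a spectator product can be
FIBRED (certificate fibration = "Fubini for certificates"). With `FibredSpectatorCancellation` it gives
`SpectatorCancellation` for one-dimensional spectators (and, iterating coordinates, for all). -/
def CertificateFibration : Prop :=
  ∀ (s : KZ.IntegralRep 1) (c : KZ.FormalRep), s.value ≠ 0 →
    KZ.of s * c ∈ KZ.relations → ∃ c' : KZ.FormalRep, c - c' ∈ KZ.relations ∧ KZ.of s * c' ∈ KZ.fibredRelations

theorem spectatorCancellation_dimOne_of (hF : CertificateFibration) (hC : FibredSpectatorCancellation)
    (s : KZ.IntegralRep 1) (c : KZ.FormalRep) (hs : s.value ≠ 0) (h : KZ.of s * c ∈ KZ.relations) :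
    c ∈ KZ.relations := by
  obtain ⟨c', hcc', hc'⟩ := hF s c hs h
  have : c' ∈ KZ.relations := hC s c' hs hc'
  have := KZ.relations.add_mem hcc' this
  simpa using this

end Summit.KontsevichZagierPeriods.KontsevichZagierPeriods.Cruxes.LogKernelConjecture.SpectatorLocalisation
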